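import Mathlib
import Literature.Computability.Complexity.RangeAvoidance
import Literature.Computability.Complexity.SignDegreeXor
import Summits.PneNP.PneNP.Theorems.PstarPDT
import Summits.PneNP.PneNP.Theorems.PstarFibrePolys
import Summits.PneNP.PneNP.Theorems.PstarSALevel
import Summits.PneNP.PneNP.Theorems.PstarTyped
import Summits.PneNP.PneNP.Theorems.PstarGapLinearised
import Summits.PneNP.PneNP.Theorems.PstarGapPeeling
import Summits.PneNP.PneNP.Theorems.PstarCentreFree
import Summits.PneNP.PneNP.Theorems.PstarChordRepair
import Summits.PneNP.PneNP.Theorems.PstarGapOneAndRepair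
import Summits.PneNP.PneNP.Theorems.PstarGapOneAll
import Summits.PneNP.PneNP.Theorems.PstarGConstraint
import Summits.PneNP.PneNP.Theorems.PstarGSatChord
import Summits.PneNP.PneNP.Theorems.PstarGSatStructure

/-!
# The reader-graph induction: the `C₄` endgame of step (e) (ROUND-24 item T24.17′)

FRONTIER range-avoidance ladder, rung F-N3, ROUND 24 (cell `pnp-ideate`; restricted-model proof complexity — nothing here bears on
`P` versus `NP`).  Memo ROUND-24-PRESEED §13 R10(p)(e), case `ch = 2`; referee AUDIT-r10p-gsat-g43 (P1, P2).

Configuration: `J = {g₁, g₂, f₁, f₂}` with chords `g₁ ≠ g₂` (AND pairs `P₁, P₂` `J`-private), and `f₁, f₂` non-chords each with a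
private AND slot (leaf) and a common other AND variable `d`; every pair of `G` meets `P₁` and `P₂`; `C ⊆ P₁ ∪ P₂`; the constraint is
non-constant and misses `b` on `Sol(J)`.  **`c4_false`**: impossible.  Proof: `PstarCentreFree.claim` gives a solution with `d`
active; for each chord, flipping one of its XOR variables not read by the other chord (simple overlaps) and repairing `f₁, f₂` by
their leaves yields a solution in which both chords sit at `(0,0)` (`settle`); then raising single chord variables, and pairs across
the two chords, stays inside `Sol(J)`, and `bit_gval_update_and` reads off `C ∩ (P₁ ∪ P₂) = ∅` and "no `G`-pair in `P₁ × P₂`" —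
so `C = ∅ = G`, contradicting non-constancy.
-/

set_option linter.dupNamespace false -- `Summit.PneNP.PneNP.…`: summit = sub-problem name (D-0017 single-conjunct layout)

open Finset Literature.Computability.Complexity
open Summit.PneNP.PneNP.Theorems.PstarPDT (parity)
open Summit.PneNP.PneNP.Theorems.PstarFibrePolys (bit bit_injective)
open Summit.PneNP.PneNP.Theorems.PstarTyped (Typed)
open Summit.PneNP.PneNP.Theorems.PstarSALevel (varSet bdry BoundaryExpanding SimpleOverlap)
open Summit.PneNP.PneNP.Theorems.PstarGapLinearised (andPair)
open Summit.PneNP.PneNP.Theorems.PstarGapPeeling (not_mem_varSet_of_private eval_update_of_not_mem eval_pure eval_update_xor_slot)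
open Summit.PneNP.PneNP.Theorems.PstarCentreFree (vars_mem_varSet)
open Summit.PneNP.PneNP.Theorems.PstarChordRepair (IsChord eval_setPair_self eval_setPair_of_ne)
open Summit.PneNP.PneNP.Theorems.PstarGapOneAndRepair (eval_update_and_slot)
open Summit.PneNP.PneNP.Theorems.PstarGapOneAll (gval)
open Summit.PneNP.PneNP.Theorems.PstarGConstraint
open Summit.PneNP.PneNP.Theorems.PstarGSatChord
open Summit.PneNP.PneNP.Theorems.PstarGSatStructure

namespace Summit.PneNP.PneNP.Theorems.PstarGSatC4

variable {n m : ℕ}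

/-- Two Booleans avoiding the same value are equal. -/
private theorem bool_eq_of_ne {x x' b : Bool} (hx : x ≠ b) (hx' : x' ≠ b) : x = x' := by
  revert hx hx'; cases x <;> cases x' <;> cases b <;> decide

section C4

variable (I : LocalMap 4 n m) (hI : I.IsPure xorAndPred) (hT : Typed I) {r : ℕ} (hB : BoundaryExpanding r I) (hS : SimpleOverlap I)
  (y : Fin m → Bool) (J G : Finset (Fin m)) (C : Finset (Fin n)) (b : Bool) (hJr : J.card ≤ r) (hJG : Disjoint J G)
  (hnc : ∃ z z' : Fin n → Bool, gval I C G z ≠ gval I C G z')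
  (hunsat : ∀ z : Fin n → Bool, (∀ j ∈ J, I.eval z j = y j) → gval I C G z ≠ b)
  {g₁ g₂ f₁ f₂ : Fin m} (hg₁ : g₁ ∈ J) (hg₂ : g₂ ∈ J) (hc₁ : IsChord I J g₁) (hc₂ : IsChord I J g₂) (hne : g₁ ≠ g₂)
  (hf₁ : f₁ ∈ J) (hf₂ : f₂ ∈ J) (hf₁c : ¬ IsChord I J f₁) (hf₂c : ¬ IsChord I J f₂)
  {sa₁ sd₁ sa₂ sd₂ : Fin 4} (ha₁ : 2 ≤ sa₁.val) (hd₁ : 2 ≤ sd₁.val) (had₁ : sa₁ ≠ sd₁)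
  (ha₂ : 2 ≤ sa₂.val) (hd₂ : 2 ≤ sd₂.val) (had₂ : sa₂ ≠ sd₂)
  (hl₁ : I.vars f₁ sa₁ ∈ bdry I J) (hl₂ : I.vars f₂ sa₂ ∈ bdry I J) (hdd : I.vars f₁ sd₁ = I.vars f₂ sd₂)
  (hJ : ∀ j ∈ J, j = g₁ ∨ j = g₂ ∨ j = f₁ ∨ j = f₂)

include hI

/-- Leaf repair: with the partner `true`, output `f` is fixed by its private AND slot. -/
theorem leaf_fix {f : Fin m} {sa sd : Fin 4} (ha : 2 ≤ sa.val) (hd : 2 ≤ sd.val) (had : sa ≠ sd) (z : Fin n → Bool)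
    (hzd : z (I.vars f sd) = true) : ∃ a : Bool, I.eval (Function.update z (I.vars f sa) a) f = y f := by
  by_cases h : I.eval z f = y f
  · exact ⟨z (I.vars f sa), by rw [Function.update_eq_self]; exact h⟩
  · refine ⟨!z (I.vars f sa), ?_⟩
    rw [eval_update_and_slot I hI z f sa sd ha hd had hzd]
    revert h; cases I.eval z f <;> cases y f <;> simp

include hT hS hg₁ hg₂ hc₁ hc₂ hne hf₁ hf₂ hf₁c hf₂c ha₁ hd₁ had₁ ha₂ hd₂ had₂ hl₁ hl₂ hdd hJ

/-- **Settling one chord**: from a solution with `d` active, reach a solution with `d` active, the chord `g` at `(0,0)`, and the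
other chord's AND values unchanged. -/
theorem settle {g g' : Fin m} (hg : g ∈ J) (hc : IsChord I J g) (hg' : g' ∈ J) (hc' : IsChord I J g') (hgg : g ≠ g')
    (z : Fin n → Bool) (hz : ∀ j ∈ J, I.eval z j = y j) (hzd : z (I.vars f₁ sd₁) = true) :
    ∃ z' : Fin n → Bool, (∀ j ∈ J, I.eval z' j = y j) ∧ z' (I.vars f₁ sd₁) = true ∧
      z' (I.vars g 2) = false ∧ z' (I.vars g 3) = false ∧
      z' (I.vars g' 2) = z (I.vars g' 2) ∧ z' (I.vars g' 3) = z (I.vars g' 3) := by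
  classical
  -- basic distinctness
  have hfg : ∀ {f : Fin m}, f ∈ J → ¬ IsChord I J f → f ≠ g := fun hf hfc h => hfc (h ▸ hc)
  have hPg : ∀ s : Fin 4, 2 ≤ s.val → ∀ j ∈ J, j ≠ g → I.vars g s ∉ varSet I j := by
    intro s hs j hj hjg
    have : s = 2 ∨ s = 3 := by fin_cases s <;> simp at hs ⊢
    rcases this with rfl | rfl
    · exact not_mem_varSet_of_private I hg hj hjg hc.1 (vars_mem_varSet I g 2)
    · exact not_mem_varSet_of_private I hg hj hjg hc.2 (vars_mem_varSet I g 3)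
  have hd_ne_g : ∀ s : Fin 4, 2 ≤ s.val → I.vars f₁ sd₁ ≠ I.vars g s := fun s hs h =>
    hPg s hs f₁ hf₁ (hfg hf₁ hf₁c) (h ▸ vars_mem_varSet I f₁ sd₁)
  have hl₁g : ∀ j ∈ J, j ≠ f₁ → I.vars f₁ sa₁ ∉ varSet I j := fun j hj hne =>
    not_mem_varSet_of_private I hf₁ hj hne hl₁ (vars_mem_varSet I f₁ sa₁)
  have hl₂g : ∀ j ∈ J, j ≠ f₂ → I.vars f₂ sa₂ ∉ varSet I j := fun j hj hne =>
    not_mem_varSet_of_private I hf₂ hj hne hl₂ (vars_mem_varSet I f₂ sa₂)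
  have hd_ne_l₁ : I.vars f₁ sd₁ ≠ I.vars f₁ sa₁ := fun h => had₁ (hI.2 f₁ h).symm
  have hd_ne_l₂ : I.vars f₁ sd₁ ≠ I.vars f₂ sa₂ := fun h => had₂ (hI.2 f₂ (hdd.symm.trans h)).symm
  -- an XOR slot of `g` not read by `g'`
  obtain ⟨sx, hsx, hxg'⟩ : ∃ s : Fin 4, s.val < 2 ∧ I.vars g s ∉ varSet I g' := by
    by_contra hno
    push Not at hno
    have h01 : I.vars g 0 ≠ I.vars g 1 := fun h => absurd (hI.2 g h) (by decide)
    have hsub : ({I.vars g 0, I.vars g 1} : Finset (Fin n)) ⊆ varSet I g ∩ varSet I g' := by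
      intro v hv
      rw [mem_insert, mem_singleton] at hv
      rw [mem_inter]
      rcases hv with rfl | rfl
      · exact ⟨vars_mem_varSet I g 0, hno 0 (by decide)⟩
      · exact ⟨vars_mem_varSet I g 1, hno 1 (by decide)⟩
    have := (card_le_card hsub).trans (hS g g' hgg)
    rw [card_pair h01] at this
    omega
  -- step 1: make the chord want product 0 (flip `vars g sx` if needed)
  obtain ⟨w, hw, hwx, hwA, hwg'⟩ : ∃ w : Fin n → Bool,
      (w = z ∨ w = Function.update z (I.vars g sx) (!z (I.vars g sx))) ∧
      xor (xor (w (I.vars g 0)) (w (I.vars g 1))) false = y g ∧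
      (∀ (j : Fin m) (s : Fin 4), 2 ≤ s.val → w (I.vars j s) = z (I.vars j s)) ∧ I.eval w g' = y g' := by
    by_cases h : xor (xor (z (I.vars g 0)) (z (I.vars g 1))) false = y g
    · exact ⟨z, Or.inl rfl, h, fun _ _ _ => rfl, hz g' hg'⟩
    · refine ⟨_, Or.inr rfl, ?_, fun j s hs => ?_, ?_⟩
      · have h01 : I.vars g 0 ≠ I.vars g 1 := fun e => absurd (hI.2 g e) (by decide)
        have : sx = 0 ∨ sx = 1 := by fin_cases sx <;> simp at hsx ⊢
        rcases this with rfl | rfl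
        · rw [Function.update_self, Function.update_of_ne h01.symm]
          revert h; cases z (I.vars g 0) <;> cases z (I.vars g 1) <;> cases y g <;> decide
        · rw [Function.update_self, Function.update_of_ne h01]
          revert h; cases z (I.vars g 0) <;> cases z (I.vars g 1) <;> cases y g <;> decide
      · rw [Function.update_of_ne fun e => hT g j sx s hsx hs e.symm]
      · rw [eval_update_of_not_mem I g' z hxg']; exact hz g' hg'
  -- step 2: pair of `g` to 00
  obtain ⟨w₁, hw₁⟩ : ∃ w₁ : Fin n → Bool, w₁ = Function.update (Function.update w (I.vars g 2) false) (I.vars g 3) false := ⟨_, rfl⟩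
  have hw₁g : I.eval w₁ g = y g := by rw [hw₁, eval_setPair_self I hI, Bool.and_false]; exact hwx
  have hw₁g' : I.eval w₁ g' = y g' := by rw [hw₁, eval_setPair_of_ne I hg hg' hgg.symm hc]; exact hwg'
  have hw₁d : w₁ (I.vars f₁ sd₁) = true := by
    rw [hw₁, Function.update_of_ne (hd_ne_g 3 (by decide)), Function.update_of_ne (hd_ne_g 2 (by decide)), hwA f₁ sd₁ hd₁]
    exact hzd
  have hw₁P' : ∀ s : Fin 4, 2 ≤ s.val → w₁ (I.vars g' s) = z (I.vars g' s) := by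
    intro s hs
    rw [hw₁, Function.update_of_ne, Function.update_of_ne, hwA g' s hs]
    · exact fun h => hPg 2 (by decide) g' hg' hgg.symm (h ▸ vars_mem_varSet I g' s)
    · exact fun h => hPg 3 (by decide) g' hg' hgg.symm (h ▸ vars_mem_varSet I g' s)
  have hw₁P : w₁ (I.vars g 2) = false ∧ w₁ (I.vars g 3) = false := by
    have h23 : I.vars g 2 ≠ I.vars g 3 := fun h => absurd (hI.2 g h) (by decide)
    rw [hw₁, Function.update_self, Function.update_of_ne h23, Function.update_self]
    exact ⟨rfl, rfl⟩
  -- step 3: repair `f₁` by its leaf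
  have hgf₁ : g ≠ f₁ := fun e => hf₁c (e ▸ hc)
  have hgf₂ : g ≠ f₂ := fun e => hf₂c (e ▸ hc)
  have hg'f₁ : g' ≠ f₁ := fun e => hf₁c (e ▸ hc')
  have hg'f₂ : g' ≠ f₂ := fun e => hf₂c (e ▸ hc')
  obtain ⟨a₁, ha₁'⟩ := leaf_fix I hI y ha₁ hd₁ had₁ w₁ hw₁d
  obtain ⟨w₂, hw₂⟩ : ∃ w₂ : Fin n → Bool, w₂ = Function.update w₁ (I.vars f₁ sa₁) a₁ := ⟨_, rfl⟩
  have hw₂f₁ : I.eval w₂ f₁ = y f₁ := by rw [hw₂]; exact ha₁'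
  have hw₂o : ∀ j ∈ J, j ≠ f₁ → I.eval w₂ j = I.eval w₁ j := fun j hj hjf => by
    rw [hw₂, eval_update_of_not_mem I j w₁ (hl₁g j hj hjf)]
  have hw₂d : w₂ (I.vars f₂ sd₂) = true := by
    rw [hw₂, ← hdd, Function.update_of_ne hd_ne_l₁]; exact hw₁d
  -- step 4: repair `f₂` by its leaf
  obtain ⟨a₂, ha₂'⟩ := leaf_fix I hI y ha₂ hd₂ had₂ w₂ hw₂d
  obtain ⟨w₃, hw₃⟩ : ∃ w₃ : Fin n → Bool, w₃ = Function.update w₂ (I.vars f₂ sa₂) a₂ := ⟨_, rfl⟩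
  have hw₃o : ∀ j ∈ J, j ≠ f₂ → I.eval w₃ j = I.eval w₂ j := fun j hj hjf => by
    rw [hw₃, eval_update_of_not_mem I j w₂ (hl₂g j hj hjf)]
  refine ⟨w₃, fun j hj => ?_, ?_, ?_, ?_, ?_, ?_⟩
  · by_cases hjf₂ : j = f₂
    · subst hjf₂; rw [hw₃]; exact ha₂'
    rw [hw₃o j hj hjf₂]
    by_cases hjf₁ : j = f₁
    · subst hjf₁; exact hw₂f₁
    rw [hw₂o j hj hjf₁]
    rcases hJ j hj with rfl | rfl | rfl | rfl
    · by_cases hjg : j = g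
      · rw [hjg]; exact hw₁g
      · by_cases hjg' : j = g'
        · rw [hjg']; exact hw₁g'
        · -- `g₁` is neither `g` nor `g'`: then `{g, g'} ⊆ {g₂, f₁, f₂}`, impossible for two distinct chords
          exfalso
          rcases hJ g hg with h | h | h | h
          · exact hjg h.symm
          · rcases hJ g' hg' with h' | h' | h' | h'
            · exact hjg' h'.symm
            · exact hgg (h.trans h'.symm)
            · exact hf₁c (h' ▸ hc')
            · exact hf₂c (h' ▸ hc')
          · exact hf₁c (h ▸ hc)
          · exact hf₂c (h ▸ hc)
    · by_cases hjg : j = g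
      · rw [hjg]; exact hw₁g
      · by_cases hjg' : j = g'
        · rw [hjg']; exact hw₁g'
        · exfalso
          rcases hJ g hg with h | h | h | h
          · rcases hJ g' hg' with h' | h' | h' | h'
            · exact hgg (h.trans h'.symm)
            · exact hjg' h'.symm
            · exact hf₁c (h' ▸ hc')
            · exact hf₂c (h' ▸ hc')
          · exact hjg h.symm
          · exact hf₁c (h ▸ hc)
          · exact hf₂c (h ▸ hc)
    · exact absurd rfl hjf₁
    · exact absurd rfl hjf₂
  · rw [hw₃, Function.update_of_ne hd_ne_l₂, hw₂, Function.update_of_ne hd_ne_l₁]; exact hw₁d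
  · have e2 : I.vars g 2 ≠ I.vars f₂ sa₂ := fun h => hl₂g g hg hgf₂ (h ▸ vars_mem_varSet I g 2)
    have e1 : I.vars g 2 ≠ I.vars f₁ sa₁ := fun h => hl₁g g hg hgf₁ (h ▸ vars_mem_varSet I g 2)
    rw [hw₃, Function.update_of_ne e2, hw₂, Function.update_of_ne e1]
    exact hw₁P.1
  · have e2 : I.vars g 3 ≠ I.vars f₂ sa₂ := fun h => hl₂g g hg hgf₂ (h ▸ vars_mem_varSet I g 3)
    have e1 : I.vars g 3 ≠ I.vars f₁ sa₁ := fun h => hl₁g g hg hgf₁ (h ▸ vars_mem_varSet I g 3)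
    rw [hw₃, Function.update_of_ne e2, hw₂, Function.update_of_ne e1]
    exact hw₁P.2
  · have e2 : I.vars g' 2 ≠ I.vars f₂ sa₂ := fun h => hl₂g g' hg' hg'f₂ (h ▸ vars_mem_varSet I g' 2)
    have e1 : I.vars g' 2 ≠ I.vars f₁ sa₁ := fun h => hl₁g g' hg' hg'f₁ (h ▸ vars_mem_varSet I g' 2)
    rw [hw₃, Function.update_of_ne e2, hw₂, Function.update_of_ne e1, hw₁P' 2 (by decide)]
  · have e2 : I.vars g' 3 ≠ I.vars f₂ sa₂ := fun h => hl₂g g' hg' hg'f₂ (h ▸ vars_mem_varSet I g' 3)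
    have e1 : I.vars g' 3 ≠ I.vars f₁ sa₁ := fun h => hl₁g g' hg' hg'f₁ (h ▸ vars_mem_varSet I g' 3)
    rw [hw₃, Function.update_of_ne e2, hw₂, Function.update_of_ne e1, hw₁P' 3 (by decide)]

include hB hJr hnc hunsat

/-- **The `C₄` endgame is impossible.** -/
theorem c4_false
    (hmeet : ∀ g' ∈ G, (I.vars g₁ 2 ∈ andPair I g' ∨ I.vars g₁ 3 ∈ andPair I g') ∧
      (I.vars g₂ 2 ∈ andPair I g' ∨ I.vars g₂ 3 ∈ andPair I g'))
    (hCsub : ∀ v ∈ C, v = I.vars g₁ 2 ∨ v = I.vars g₁ 3 ∨ v = I.vars g₂ 2 ∨ v = I.vars g₂ 3) : False := by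
  classical
  obtain ⟨hnd, hdist⟩ := andPairs_simple I hI hS G
  -- private chord variables
  have hP : ∀ {g : Fin m}, g ∈ J → IsChord I J g → ∀ s : Fin 4, 2 ≤ s.val → ∀ j ∈ J, j ≠ g → I.vars g s ∉ varSet I j := by
    intro g hg hc s hs j hj hjg
    have : s = 2 ∨ s = 3 := by fin_cases s <;> simp at hs ⊢
    rcases this with rfl | rfl
    · exact not_mem_varSet_of_private I hg hj hjg hc.1 (vars_mem_varSet I g 2)
    · exact not_mem_varSet_of_private I hg hj hjg hc.2 (vars_mem_varSet I g 3)
  have hP12 : ∀ s t : Fin 4, 2 ≤ s.val → 2 ≤ t.val → I.vars g₁ s ≠ I.vars g₂ t := fun s t hs ht h =>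
    hP hg₁ hc₁ s hs g₂ hg₂ hne.symm (h ▸ vars_mem_varSet I g₂ t)
  -- far ends of pairs through one chord lie in the other chord
  have hfar : ∀ {g g' : Fin m}, g ∈ J → IsChord I J g → g' ∈ J → IsChord I J g' → g ≠ g' →
      (∀ k ∈ G, I.vars g' 2 ∈ andPair I k ∨ I.vars g' 3 ∈ andPair I k) →
      ∀ s : Fin 4, 2 ≤ s.val → ∀ x ∈ nbG I G (I.vars g s), x = I.vars g' 2 ∨ x = I.vars g' 3 := by
    intro g g' hg hc hg' hc' hgg hmeet' s hs x hx
    obtain ⟨k, hk, hmem, hox⟩ := mem_nbG.1 hx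
    have hpair := pair_eq_of_mem I (I.vars g s) hmem
    have hm := hmeet' k hk
    rw [← hpair, mem_insert, mem_singleton, mem_insert, mem_singleton, hox] at hm
    have hne2 : I.vars g' 2 ≠ I.vars g s := fun h => hP hg hc s hs g' hg' (Ne.symm hgg) (h ▸ vars_mem_varSet I g' 2)
    have hne3 : I.vars g' 3 ≠ I.vars g s := fun h => hP hg hc s hs g' hg' (Ne.symm hgg) (h ▸ vars_mem_varSet I g' 3)
    rcases hm with (h | h) | (h | h)
    · exact absurd h hne2
    · exact Or.inl h.symm
    · exact absurd h hne3
    · exact Or.inr h.symm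
  have hfar₁ := fun s hs => hfar hg₁ hc₁ hg₂ hc₂ hne (fun k hk => (hmeet k hk).2) s hs
  have hfar₂ := fun s hs => hfar hg₂ hc₂ hg₁ hc₁ hne.symm (fun k hk => (hmeet k hk).1) s hs
  -- a solution with `d` active and both chords at `(0,0)`
  have hdX : ∀ (g : Fin m) (s : Fin 4), s.val < 2 → I.vars g s ≠ I.vars f₁ sd₁ := fun g s hs h => hT g f₁ s sd₁ hs hd₁ h
  obtain ⟨z₀, hz₀, hz₀d⟩ := PstarCentreFree.claim I hI hB hS y J hJr (I.vars f₁ sd₁) hdX true J Subset.rfl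
  obtain ⟨z₁, hz₁, hz₁d, h12, h13, -, -⟩ := settle I hI hT hS y J hg₁ hg₂ hc₁ hc₂ hne hf₁ hf₂ hf₁c hf₂c ha₁ hd₁ had₁ ha₂ hd₂ had₂
    hl₁ hl₂ hdd hJ hg₁ hc₁ hg₂ hc₂ hne z₀ hz₀ hz₀d
  obtain ⟨z, hz, -, h22, h23, e12, e13⟩ := settle I hI hT hS y J hg₁ hg₂ hc₁ hc₂ hne hf₁ hf₂ hf₁c hf₂c ha₁ hd₁ had₁ ha₂ hd₂ had₂
    hl₁ hl₂ hdd hJ hg₂ hc₂ hg₁ hc₁ hne.symm z₁ hz₁ hz₁d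
  rw [h12] at e12
  rw [h13] at e13
  have hzero : ∀ (g : Fin m), (g = g₁ ∨ g = g₂) → ∀ s : Fin 4, 2 ≤ s.val → z (I.vars g s) = false := by
    rintro g (rfl | rfl) s hs
    · have : s = 2 ∨ s = 3 := by fin_cases s <;> simp at hs ⊢
      rcases this with rfl | rfl
      exacts [e12, e13]
    · have : s = 2 ∨ s = 3 := by fin_cases s <;> simp at hs ⊢
      rcases this with rfl | rfl
      exacts [h22, h23]
  -- raising one chord variable whose partner is `false` keeps a solution
  have hraise : ∀ (w : Fin n → Bool), (∀ j ∈ J, I.eval w j = y j) → ∀ {g : Fin m}, g ∈ J → IsChord I J g →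
      ∀ s t : Fin 4, 2 ≤ s.val → 2 ≤ t.val → s ≠ t → w (I.vars g t) = false →
        ∀ j ∈ J, I.eval (Function.update w (I.vars g s) true) j = y j := by
    intro w hw g hg hc s t hs ht hst hwt j hj
    by_cases hjg : j = g
    · subst hjg
      rw [← hw j hj, eval_pure I hI, eval_pure I hI]
      have hinj := hI.2 j
      have hn : ∀ a c : Fin 4, a ≠ c → I.vars j a ≠ I.vars j c := fun a c hac h => hac (hinj h)
      rw [Function.update_of_ne (hn 0 s (by intro e; subst e; simp at hs)),
        Function.update_of_ne (hn 1 s (by intro e; subst e; simp at hs))]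
      have : (s = 2 ∧ t = 3) ∨ (s = 3 ∧ t = 2) := by
        fin_cases s <;> fin_cases t
        all_goals first
          | exact Or.inl ⟨rfl, rfl⟩
          | exact Or.inr ⟨rfl, rfl⟩
          | exact absurd rfl hst
          | exact absurd hs (by decide)
          | exact absurd ht (by decide)
      rcases this with ⟨rfl, rfl⟩ | ⟨rfl, rfl⟩
      · rw [Function.update_self, Function.update_of_ne (hn 3 2 (by decide)), hwt, Bool.and_false, Bool.and_false]
      · rw [Function.update_self, Function.update_of_ne (hn 2 3 (by decide)), hwt, Bool.false_and, Bool.false_and]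
    · rw [eval_update_of_not_mem I j w (hP hg hc s hs j hj hjg)]
      exact hw j hj
  -- alpha vanishes at every chord variable
  have halpha : ∀ (w : Fin n → Bool), (∀ j ∈ J, I.eval w j = y j) → ∀ {g : Fin m}, g ∈ J → IsChord I J g →
      ∀ s t : Fin 4, 2 ≤ s.val → 2 ≤ t.val → s ≠ t → w (I.vars g t) = false → w (I.vars g s) = false →
        alpha I C G w (I.vars g s) = 0 := by
    intro w hw g hg hc s t hs ht hst hwt hws
    have h1 := hunsat w hw
    have h2 := hunsat _ (hraise w hw hg hc s t hs ht hst hwt)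
    have e := bit_gval_update_and I C hnd w (I.vars g s) true
    rw [bool_eq_of_ne h2 h1, hws] at e
    have : bit true + bit false = (1 : ZMod 2) := rfl
    rw [this, one_mul] at e
    linear_combination -e
  -- (i) no chord variable in `C`
  have hPC : ∀ (g g' : Fin m), (g = g₁ ∧ g' = g₂ ∨ g = g₂ ∧ g' = g₁) → ∀ s : Fin 4, 2 ≤ s.val → I.vars g s ∉ C := by
    rintro g g' hgg' s hs hsC
    obtain ⟨t, ht, hst⟩ : ∃ t : Fin 4, 2 ≤ t.val ∧ s ≠ t := by
      have : s = 2 ∨ s = 3 := by fin_cases s <;> simp at hs ⊢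
      rcases this with rfl | rfl
      exacts [⟨3, by decide, by decide⟩, ⟨2, by decide, by decide⟩]
    have hg12 : g = g₁ ∨ g = g₂ := by rcases hgg' with ⟨h, -⟩ | ⟨h, -⟩ <;> simp [h]
    have hgJ : g ∈ J := by rcases hg12 with rfl | rfl <;> assumption
    have hgc : IsChord I J g := by rcases hg12 with rfl | rfl <;> assumption
    have ha := halpha z hz hgJ hgc s t hs ht hst (hzero g hg12 t ht) (hzero g hg12 s hs)
    rw [alpha_eq I C hdist, if_pos hsC] at ha
    have hsum : ∑ x ∈ nbG I G (I.vars g s), bit (z x) = 0 := by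
      refine sum_eq_zero fun x hx => ?_
      have hx' : x = I.vars g' 2 ∨ x = I.vars g' 3 := by
        rcases hgg' with ⟨rfl, rfl⟩ | ⟨rfl, rfl⟩
        · exact hfar₁ s hs x hx
        · exact hfar₂ s hs x hx
      have hg'12 : g' = g₁ ∨ g' = g₂ := by rcases hgg' with ⟨-, h⟩ | ⟨-, h⟩ <;> simp [h]
      rcases hx' with rfl | rfl
      · rw [hzero g' hg'12 2 (by decide)]; rfl
      · rw [hzero g' hg'12 3 (by decide)]; rfl
    rw [hsum, add_zero] at ha
    exact one_ne_zero ha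
  -- (ii) no pair across the two chords
  have hnopair : ∀ s t : Fin 4, 2 ≤ s.val → 2 ≤ t.val → I.vars g₁ s ∉ nbG I G (I.vars g₂ t) := by
    intro s t hs ht hmem
    obtain ⟨s', hs', hss'⟩ : ∃ s' : Fin 4, 2 ≤ s'.val ∧ s ≠ s' := by
      have : s = 2 ∨ s = 3 := by fin_cases s <;> simp at hs ⊢
      rcases this with rfl | rfl
      exacts [⟨3, by decide, by decide⟩, ⟨2, by decide, by decide⟩]
    obtain ⟨t', ht', htt'⟩ : ∃ t' : Fin 4, 2 ≤ t'.val ∧ t ≠ t' := by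
      have : t = 2 ∨ t = 3 := by fin_cases t <;> simp at ht ⊢
      rcases this with rfl | rfl
      exacts [⟨3, by decide, by decide⟩, ⟨2, by decide, by decide⟩]
    -- raise `u = vars g₁ s`
    obtain ⟨z', hz'⟩ : ∃ z' : Fin n → Bool, z' = Function.update z (I.vars g₁ s) true := ⟨_, rfl⟩
    have hz'sol : ∀ j ∈ J, I.eval z' j = y j := by
      rw [hz']; exact hraise z hz hg₁ hc₁ s s' hs hs' hss' (hzero g₁ (Or.inl rfl) s' hs')
    have hz'2 : ∀ t₀ : Fin 4, 2 ≤ t₀.val → z' (I.vars g₂ t₀) = false := fun t₀ ht₀ => by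
      rw [hz', Function.update_of_ne (hP12 s t₀ hs ht₀).symm]; exact hzero g₂ (Or.inr rfl) t₀ ht₀
    have ha := halpha z' hz'sol hg₂ hc₂ t t' ht ht' htt' (hz'2 t' ht') (hz'2 t ht)
    rw [alpha_eq I C hdist, if_neg (hPC g₂ g₁ (Or.inr ⟨rfl, rfl⟩) t ht)] at ha
    have hsum : ∑ x ∈ nbG I G (I.vars g₂ t), bit (z' x) = 1 := by
      rw [sum_eq_single_of_mem (I.vars g₁ s) hmem fun x hx hxu => ?_]
      · rw [hz', Function.update_self]; rfl
      · rcases hfar₂ t ht x hx with rfl | rfl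
        · rw [hz', Function.update_of_ne hxu, hzero g₁ (Or.inl rfl) 2 (by decide)]; rfl
        · rw [hz', Function.update_of_ne hxu, hzero g₁ (Or.inl rfl) 3 (by decide)]; rfl
    rw [hsum, zero_add] at ha
    exact one_ne_zero ha
  -- hence `G = ∅` and `C = ∅`
  have hG : G = ∅ := by
    by_contra hG
    obtain ⟨k, hk⟩ := nonempty_iff_ne_empty.2 hG
    obtain ⟨h1, h2⟩ := hmeet k hk
    obtain ⟨s, hs, hu⟩ : ∃ s : Fin 4, 2 ≤ s.val ∧ I.vars g₁ s ∈ andPair I k := by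
      rcases h1 with h | h
      exacts [⟨2, by decide, h⟩, ⟨3, by decide, h⟩]
    obtain ⟨t, ht, hv⟩ : ∃ t : Fin 4, 2 ≤ t.val ∧ I.vars g₂ t ∈ andPair I k := by
      rcases h2 with h | h
      exacts [⟨2, by decide, h⟩, ⟨3, by decide, h⟩]
    apply hnopair s t hs ht
    exact mem_nbG.2 ⟨k, hk, hv, other_eq_of_mem I hu hv (hP12 s t hs ht)⟩
  have hC : C = ∅ := by
    by_contra hC
    obtain ⟨v, hv⟩ := nonempty_iff_ne_empty.2 hC
    rcases hCsub v hv with rfl | rfl | rfl | rfl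
    · exact hPC g₁ g₂ (Or.inl ⟨rfl, rfl⟩) 2 (by decide) hv
    · exact hPC g₁ g₂ (Or.inl ⟨rfl, rfl⟩) 3 (by decide) hv
    · exact hPC g₂ g₁ (Or.inr ⟨rfl, rfl⟩) 2 (by decide) hv
    · exact hPC g₂ g₁ (Or.inr ⟨rfl, rfl⟩) 3 (by decide) hv
  rcases (gval_nonconst_iff I hnd hdist).1 hnc with h | h
  · exact h hC
  · exact h hG

end C4

end Summit.PneNP.PneNP.Theorems.PstarGSatC4
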